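import Literature.NumberTheory.EllipticCurves.EisensteinNewformLevelRaisingWashingtonProofs
import Literature.NumberTheory.EllipticCurves.EisensteinSeriesTwoCharacterWeightOneCuspsNormalised
import Literature.NumberTheory.EllipticCurves.EisensteinNewformLevelRaisingOddAssemblyProofs
import HarnessLib

/-!
# Billerey–Menares 2016, Thm. 2.2 for every odd prime `p`: the weight-`3` Eisenstein product and
# the discharge `BillereyMenares2016_thm22_exists_newform_odd_holds` (proofs only)

Topic `Literature/NumberTheory/EllipticCurves`; namespaces
`Literature.NumberTheory.EllipticCurves.ModularForms.WashingtonLift` (the weight-`3` product and the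
cuspidal congruence) and `Literature.NumberTheory.EllipticCurves` (the discharge).  THEOREMS ONLY
(no definition, no named fact; D-0026).

The named fact `BillereyMenares2016_thm22_exists_newform_odd` (`EisensteinNewformLevelRaising`) —
Billerey–Menares 2016, Thm. 2.2 for all odd primes `p` (including `p = 3` and the primes
`p ∣ φ(NM)`, on which the printed proof is silent) — is PROVED here:

* `BillereyMenares2016_thm22_exists_newform_odd_of_cuspidalCongruence`
  (`EisensteinNewformLevelRaisingOddAssemblyProofs`) reduces it to the cuspidal congruence `hC`:
  a cusp form `f₀ ∈ S_k(NM, χ)` with the exact nebentypus, congruent to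
  `E = eisensteinLevelRaised N k χ M` (`E_k^{𝟙,χ}` minus its `M`-stabilisation); the Deligne–Serre
  lift, the newform and the dictionary to the Galois side are in the files imported there.
* `hC` is supplied WITHOUT geometric input ("Wiles' trick"): Eisenstein products with a primitive
  second-kind character `ψ` modulo `M^r` whose constant terms are `p`-adic units by Washington's
  theorem (Sinnott's proof; `exists_secondKind_two_units`), the `U_M`-descent `descend` and the
  exact-nebentypus cuspidal lift `CuspFormLift.exists_cuspForm_nebentypus_congr_of_integralForm`
  (all in `EisensteinNewformLevelRaisingWashingtonProofs` / `…IntegralFormLiftProofs`):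
  - weight `3` (`cuspidalCongruence_three_of_ne_two`, this file): the product
    `H₀ = S_1^{ψ,χ}/c₁ · S_2^{ψ̄,𝟙}/c ∈ M_3(Γ₁(N M^r))` (`exists_integralForm_three`) of the
    weight-ONE two-character series from corrected `ζ`-division values, normalised by its
    coefficient constant (`EisensteinSeriesTwoCharacterWeightOne*`: `Γ₀`-character `ψχ`,
    coefficients `σ_0^{ψ,χ}(n)`, constant terms `e₁ ψ(-c/N) χ(d)` at the cusps with `N ∣ c`, `M ∤ c`
    and `0` at those with `N ∤ c`, `M ∤ c`) with the weight-`2` factor `factorB = S_2^{ψ̄,𝟙}/c`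
    (constant terms `e₂ ψ̄(-c)`, vanishing when `M ∣ c`): `Γ₀(NM^r)`-equivariant with `χ`,
    `p`-integral, constant terms `e χ(d_γ) [N ∣ c_γ, M ∤ c_γ]` with the unit `e = e₁ e₂ ψ̄(N)`
    (`B_{1,χψ̄}` and `B_{2,ψ}/2` units: Washington with `n = 1`, `2`)
    (the parallel `WashingtonLift.cuspidalCongruence_three` of
    `EisensteinNewformLevelRaisingWeightThreeProofs`, via Hecke's one-character weight-one series,
    is stated for `5 ≤ p`; the present product covers `p = 3` as well);
  - weight `4` (`cuspidalCongruence_four_of_ne_two`): the `p ≠ 2` form of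
    `WashingtonLift.cuspidalCongruence_four` (whose proof uses `5 ≤ p` only through `p ≠ 2`);
  - weights `k ≥ 5`, where the Billerey–Menares constraint `k ∈ {p, p + 1} ∪ [3, p - 1]` forces
    `p ≥ 5`: `WashingtonLift.cuspidalCongruence_of_five_le`.

So the one input of the printed proof that is not in the tree — Katz' / Edixhoven's lifting lemma
(the named fact `Literature.NumberTheory.ModularForms.Edixhoven1997_exists_integralForm_cuspIndicator`)
— is not needed.

## References

* N. Billerey, R. Menares, *On the modularity of reducible mod `l` Galois representations*, Math.
  Res. Lett. 23 (2016), §2, Thm. 2.2 and its proof (p. 7); Prop. 1.2. [BillereyMenares2016]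
* L. C. Washington, *The non-`p`-part of the class number in a cyclotomic `ℤ_p`-extension*,
  Invent. Math. 49 (1978), 87–97. [Washington1978]
* W. Sinnott, *On a theorem of L. Washington*, Astérisque 147–148 (1987), 209–224. [Sinnott1987]
* A. Wiles, *Modular curves and the class group of `ℚ(ζ_p)`*, Invent. Math. 58 (1980), 1–35, §2.
  [Wiles1980]
* F. Diamond, J. Shurman, *A First Course in Modular Forms*, GTM 228 (2005), §4.8 (Thm. 4.8.1).
  [DiamondShurman2005]
* P. Deligne, J.-P. Serre, *Formes modulaires de poids 1*, Ann. Sci. ÉNS 7 (1974), Lemme 6.11.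
  [DeligneSerreASENS1974]
-/

noncomputable section

open scoped MatrixGroups ModularForm Topology NNReal
open CongruenceSubgroup UpperHalfPlane Filter Matrix.SpecialLinearGroup Complex
open Literature.NumberTheory.LFunctions

namespace Literature.NumberTheory.EllipticCurves.ModularForms

namespace WashingtonLift

/-! ### The weight-`1` factor `S_1^{ψ,χ}/c₁` -/

section FactorOne

variable {N : ℕ} [NeZero N] (χ : DirichletCharacter ℂ N) {M : ℕ} [hM : Fact M.Prime] {r : ℕ}
  (ψ : DirichletCharacter ℂ (M ^ r))

/-- `S_1^{ψ,χ}/c₁ ∣₁ γ = ψ(d)χ(d) · S_1^{ψ,χ}/c₁` for `γ ∈ Γ₀(M^r N)`. [cite: DiamondShurman2005, §4.8] -/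
theorem factorOne_slash_of_mem_gamma0 {γ : SL(2, ℤ)} (hγ : γ ∈ Gamma0 (M ^ r * N)) :
    (⇑((twoCharOneConst (M ^ r) χ)⁻¹ • twoCharOneMF ψ χ) : ℍ → ℂ) ∣[(1 : ℤ)] γ =
      (ψ ((γ 1 1 : ℤ) : ZMod (M ^ r)) * χ ((γ 1 1 : ℤ) : ZMod N)) •
        (⇑((twoCharOneConst (M ^ r) χ)⁻¹ • twoCharOneMF ψ χ) : ℍ → ℂ) := by
  rw [ModularForm.IsGLPos.coe_smul, ModularForm.SL_smul_slash,
    twoCharOneMF_slash_of_mem_gamma0 ψ χ hγ, smul_comm]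

/-- The limit of `S_1^{ψ,χ}/c₁ ∣₁ γ` at `i∞`. [cite: DiamondShurman2005, Thm. 4.8.1] -/
theorem tendsto_factorOne_slash_atImInfty (γ : SL(2, ℤ)) :
    Tendsto ((⇑((twoCharOneConst (M ^ r) χ)⁻¹ • twoCharOneMF ψ χ) : ℍ → ℂ) ∣[(1 : ℤ)] γ) atImInfty
      (𝓝 ((twoCharOneConst (M ^ r) χ)⁻¹ * twoCharOneCusp ψ χ γ)) := by
  rw [ModularForm.IsGLPos.coe_smul, ModularForm.SL_smul_slash]
  exact (tendsto_twoCharOneMF_slash_atImInfty ψ χ γ).const_mul _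

omit hM in
/-- An odd character is non-trivial. [folklore] -/
theorem ne_one_of_apply_neg_one {L : ℕ} (θ : DirichletCharacter ℂ L) (hodd : θ (-1) = -1) :
    θ ≠ 1 := by
  intro h
  rw [h, MulChar.one_apply (isUnit_one.neg)] at hodd
  norm_num at hodd

/-- `p`-integrality of the coefficients of `S_1^{ψ,χ}/c₁` (`χ` odd primitive, `ψ` even primitive,
`r ≥ 1`). [cite: DiamondShurman2005, Thm. 4.8.1] -/
theorem valuation_qExpansion_coeff_factorOne_le_one {p : ℕ} [Fact p.Prime]
    (ι : PadicAlgCl p ≃+* ℂ) (hr : 1 ≤ r) (hψ : ψ.IsPrimitive) (hχ : χ.IsPrimitive)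
    (hχodd : χ (-1) = -1) (hψ1 : ψ (-1) = 1) (n : ℕ) :
    Valued.v (ι.symm ((qExpansion 1
      (⇑((twoCharOneConst (M ^ r) χ)⁻¹ • twoCharOneMF ψ χ) : ℍ → ℂ)).coeff n)) ≤ 1 := by
  haveI : NeZero (M ^ r * N) := ⟨mul_ne_zero (pow_ne_zero _ hM.out.ne_zero) (NeZero.ne N)⟩
  have hne : ψ ≠ 1 := ne_one_of_isPrimitive_pow ψ hr hψ
  have hχ1 : χ ≠ 1 := ne_one_of_apply_neg_one χ hχodd
  have hpar : ψ (-1) * χ (-1) = -1 := by rw [hψ1, hχodd, one_mul]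
  rw [ModularForm.IsGLPos.coe_smul,
    ModularForm.qExpansion_smul one_pos (HeckeTGamma1.one_mem_strictPeriods_Gamma1 _) _
      (twoCharOneMF ψ χ),
    PowerSeries.coeff_smul, smul_eq_mul]
  exact valuation_inv_twoCharOneConst_mul_coeff_le_one ψ χ ι hne hχ hχ1 hpar n

/-! ### The product form `H₀ = S_1^{ψ,χ}/c₁ · S_2^{ψ̄,𝟙}/c ∈ M_3(Γ₁(N M^r))` -/

/-- **The weight-`3` integral form.**  For `χ` odd primitive modulo `N`, `ψ` even primitive modulo
`M^r` (`r ≥ 1`, `M ∤ N`), the product `H₀ = S_1^{ψ,χ}/c₁ · S_2^{ψ̄,𝟙}/c ∈ M_3(Γ₁(N M^r))` is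
`Γ₀(N M^r)`-equivariant with `χ`, has `p`-integral `q`-expansion, and constant terms
`e₁ e₂ ψ̄(N) χ(d_γ) [N ∣ c_γ, M ∤ c_γ]` along `SL₂(ℤ)` (at the cusps with `M ∣ c` the weight-`2`
factor vanishes; at those with `M ∤ c` the weight-`1` factor has the constant terms of
`EisensteinSeriesTwoCharacterWeightOneCuspsNormalised`).
[cite: Wiles1980, §2 (products of Eisenstein series)] [cite: DiamondShurman2005, §4.8] -/
theorem exists_integralForm_three {p : ℕ} [Fact p.Prime] (ι : PadicAlgCl p ≃+* ℂ) (hr : 1 ≤ r)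
    (hMN : M.Coprime N) (hψ : ψ.IsPrimitive) (hχ : χ.IsPrimitive) (hχodd : χ (-1) = -1)
    (hψ1 : ψ (-1) = 1) :
    ∃ H₀ : ModularForm (Gamma1 (N * M ^ r)) ((3 : ℕ) : ℤ),
      (∀ γ : SL(2, ℤ), γ ∈ Gamma0 (N * M ^ r) →
        (⇑H₀ : ℍ → ℂ) ∣[((3 : ℕ) : ℤ)] γ = χ ((γ 1 1 : ℤ) : ZMod N) • ⇑H₀) ∧
      (∀ n : ℕ, Valued.v (ι.symm ((qExpansion 1 (⇑H₀ : ℍ → ℂ)).coeff n)) ≤ 1) ∧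
      (∀ γ : SL(2, ℤ), Tendsto ((⇑H₀ : ℍ → ℂ) ∣[((3 : ℕ) : ℤ)] γ) atImInfty
        (𝓝 (if (N : ℤ) ∣ γ 1 0 ∧ ¬ (M : ℤ) ∣ γ 1 0 then
          (twoCharOneUnit ψ χ * twoCharTwoUnit ψ⁻¹ (1 : DirichletCharacter ℂ 1) *
              ψ⁻¹ (N : ZMod (M ^ r))) * χ ((γ 1 1 : ℤ) : ZMod N) else 0))) := by
  have hne : ψ ≠ 1 := ne_one_of_isPrimitive_pow ψ hr hψ
  set A : ModularForm (Gamma1 (N * M ^ r)) 1 :=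
    restrictGamma1 (by rw [mul_comm]) ((twoCharOneConst (M ^ r) χ)⁻¹ • twoCharOneMF ψ χ)
    with hAdef
  set B : ModularForm (Gamma1 (N * M ^ r)) 2 :=
    restrictGamma1 (by rw [mul_one]; exact dvd_mul_left _ _) (factorB ψ) with hBdef
  set H₀ : ModularForm (Gamma1 (N * M ^ r)) ((3 : ℕ) : ℤ) := ModularForm.mcast (by norm_num) (A.mul B)
    with hH₀def
  have hcoe : (⇑H₀ : ℍ → ℂ) =
      (⇑((twoCharOneConst (M ^ r) χ)⁻¹ • twoCharOneMF ψ χ) : ℍ → ℂ) * ⇑(factorB ψ) := by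
    rw [hH₀def, ModularForm.coe_mcast, ModularForm.coe_mul, hAdef, hBdef, coe_restrictGamma1,
      coe_restrictGamma1]
  refine ⟨H₀, fun γ hγ ↦ ?_, fun n ↦ ?_, fun γ ↦ ?_⟩
  · -- ### `Γ₀(N M^r)`-equivariance with `χ`
    have hγA : γ ∈ Gamma0 (M ^ r * N) := by rwa [mul_comm] at hγ
    have hγr : γ ∈ Gamma0 (M ^ r) := gamma0_le_of_dvd (dvd_mul_left (M ^ r) N) hγ
    have hγB : γ ∈ Gamma0 (M ^ r * 1) := by rwa [mul_one]
    rw [hcoe, mul_slash_SL2_of_add_eq (k₁ := 1) (k₂ := 2) (by norm_num) γ,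
      factorOne_slash_of_mem_gamma0 χ ψ hγA, factorB_slash_of_mem_gamma0 ψ hγB, smul_mul_smul_comm]
    congr 1
    have hd : IsUnit ((γ 1 1 : ℤ) : ZMod (M ^ r)) := isUnit_apply11_of_mem_gamma0 hγr
    have hne0 : ψ ((γ 1 1 : ℤ) : ZMod (M ^ r)) ≠ 0 := (hd.map ψ).ne_zero
    rw [MulChar.inv_apply_eq_inv', mul_comm (ψ _) (χ _), mul_assoc, mul_inv_cancel₀ hne0, mul_one]
  · -- ### `p`-integrality (both factors are integral)
    have hq : qExpansion 1 (⇑H₀ : ℍ → ℂ) = qExpansion 1 ⇑A * qExpansion 1 ⇑B := by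
      rw [hH₀def, ModularForm.coe_mcast, ModularForm.coe_mul]
      exact ModularForm.qExpansion_mul_coe one_pos (HeckeTGamma1.one_mem_strictPeriods_Gamma1 _) A B
    rw [hq, PowerSeries.coeff_mul, map_sum]
    refine Valuation.map_sum_le _ fun ij _ ↦ ?_
    rw [map_mul, Valuation.map_mul]
    refine mul_le_one' ?_ ?_
    · rw [hAdef, coe_restrictGamma1]
      exact valuation_qExpansion_coeff_factorOne_le_one χ ψ ι hr hψ hχ hχodd hψ1 ij.1
    · rw [hBdef, coe_restrictGamma1]
      exact valuation_qExpansion_coeff_factorB_le_one ψ ι hr hψ hψ1 ij.2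
  · -- ### constant terms along `SL₂(ℤ)`
    have hA := tendsto_factorOne_slash_atImInfty χ ψ γ
    have hB := tendsto_factorB_slash_atImInfty ψ hr hψ hψ1 γ
    rw [hcoe, mul_slash_SL2_of_add_eq (k₁ := 1) (k₂ := 2) (by norm_num) γ]
    have hAB : Tendsto ((⇑((twoCharOneConst (M ^ r) χ)⁻¹ • twoCharOneMF ψ χ) : ℍ → ℂ) ∣[(1 : ℤ)] γ *
        (⇑(factorB ψ) : ℍ → ℂ) ∣[(2 : ℤ)] γ)
        atImInfty (𝓝 ((twoCharOneConst (M ^ r) χ)⁻¹ * twoCharOneCusp ψ χ γ *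
          (twoCharTwoUnit ψ⁻¹ (1 : DirichletCharacter ℂ 1) *
            ψ⁻¹ ((-(γ 1 0 : ℤ) : ℤ) : ZMod (M ^ r))))) :=
      hA.mul hB
    convert hAB using 2
    have hψinv1 : ψ⁻¹ (-1) = 1 := by rw [inv_apply_neg_one, hψ1]
    have hneg : ∀ t : ℤ, ψ ((-t : ℤ) : ZMod (M ^ r)) = ψ ((t : ℤ) : ZMod (M ^ r)) := by
      intro t; rw [Int.cast_neg, ← neg_one_mul, map_mul, hψ1, one_mul]
    have hneg' : ∀ t : ℤ, ψ⁻¹ ((-t : ℤ) : ZMod (M ^ r)) = ψ⁻¹ ((t : ℤ) : ZMod (M ^ r)) := by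
      intro t; rw [Int.cast_neg, ← neg_one_mul, map_mul, hψinv1, one_mul]
    by_cases hMc : (M : ℤ) ∣ γ 1 0
    · -- the weight-2 factor vanishes
      rw [if_neg fun h ↦ h.2 hMc, ψ⁻¹.map_nonunit (not_isUnit_of_prime_dvd hr ((dvd_neg).mpr hMc))]
      simp
    · have hcop : IsCoprime (γ 1 0 : ℤ) ((M ^ r : ℕ) : ℤ) :=
        ((ZMod.coe_int_isUnit_iff_isCoprime _ (M ^ r)).mp (isUnit_of_not_prime_dvd hMc)).symm
      by_cases hNc : (N : ℤ) ∣ γ 1 0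
      · obtain ⟨c', hc'⟩ := hNc
        rw [if_pos ⟨⟨c', hc'⟩, hMc⟩,
          inv_twoCharOneConst_mul_twoCharOneCusp_of_eq_mul ψ χ hψ hne hχ (Nat.Coprime.pow_left r hMN)
            c' hc' hcop, hneg' (γ 1 0), hneg c']
        have hMc' : ¬ (M : ℤ) ∣ c' := fun h ↦ hMc (hc' ▸ dvd_mul_of_dvd_right h _)
        have hψc := inv_apply_mul_of_not_dvd (N := N) ψ hMc'
        rw [hc']
        linear_combination (-(twoCharOneUnit ψ χ * twoCharTwoUnit ψ⁻¹ (1 : DirichletCharacter ℂ 1) *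
          χ ((γ 1 1 : ℤ) : ZMod N))) * hψc
      · rw [if_neg fun h ↦ hNc h.1,
          inv_twoCharOneConst_mul_twoCharOneCusp_of_not_dvd ψ χ hne hcop hNc, zero_mul]

end FactorOne

/-! ### The cuspidal congruence at the odd primes -/

section Final

variable {p : ℕ} [Fact p.Prime]

/-- **The cuspidal congruence `hC` for `k = 3` at every odd prime `p`, unconditionally** (product
`S_1^{ψ,χ}/c₁ · S_2^{ψ̄,𝟙}/c`, Washington's theorem with `n = 1` and `n = 2` via Sinnott,
`U_M`-descent, `CuspFormLift`). [cite: BillereyMenares2016, §2, proof of Thm. 2.2 (p. 7)]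
[cite: Washington1978, Theorem] [cite: Sinnott1987, §4.5] -/
theorem cuspidalCongruence_three_of_ne_two (ι : PadicAlgCl p ≃+* ℂ) {N : ℕ} [NeZero N]
    (χ : DirichletCharacter ℂ N) (hk : 3 ≤ 3) (M : ℕ) [NeZero M] (hp2 : p ≠ 2)
    (hχ : χ.IsPrimitive) (hpar : χ (-1) = (-1) ^ 3) (hpN : ¬ p ∣ N) (hM : M.Prime) (hMN : ¬ M ∣ N)
    (hMp : M ≠ p)
    (hcusp : ∀ γ : SL(2, ℤ), ∃ c : ℂ,
      Tendsto ((⇑(eisensteinLevelRaised N 3 χ M hk) : ℍ → ℂ) ∣[((3 : ℕ) : ℤ)] γ) atImInfty (𝓝 c) ∧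
        Valued.v (ι.symm c) < 1) :
    ∃ f₀ : CuspForm (Gamma1 (N * M)) (3 : ℕ),
      f₀ ∈ nebentypusSubspace (N * M) (3 : ℕ) (DirichletCharacter.changeLevel (dvd_mul_right N M) χ) ∧
      ∀ n, Valued.v (ι.symm (cuspCoeff f₀ n -
        (qExpansion 1 ⇑(eisensteinLevelRaised N 3 χ M hk)).coeff n)) < 1 := by
  haveI hMf : Fact M.Prime := ⟨hM⟩
  have hMN' : M.Coprime N := (Nat.Prime.coprime_iff_not_dvd hM).2 hMN
  have hpM : ¬ p ∣ M := fun h ↦ hMp ((Nat.prime_dvd_prime_iff_eq Fact.out hM).mp h).symm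
  have hχodd : χ (-1) = -1 := by rw [hpar]; norm_num
  obtain ⟨r, hr1, ψ, hψprim, hψ1, hBA, hBB⟩ := exists_secondKind_two_units ι χ hMp hp2
    (n₁ := 1) (n₂ := 2) le_rfl (by norm_num) (by rw [hχodd]; norm_num) even_two
  have hpMr : ¬ p ∣ M ^ r := fun h ↦ hpM (Nat.Prime.dvd_of_dvd_pow Fact.out h)
  have he₂ : Valued.v (ι.symm (twoCharTwoUnit ψ⁻¹ (1 : DirichletCharacter ℂ 1))) = 1 :=
    valuation_twoCharTwoUnit_eq_one ψ⁻¹ (1 : DirichletCharacter ℂ 1) ι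
      (Literature.NumberTheory.LFunctions.isPrimitive_inv ψ hψprim)
      DirichletCharacter.isPrimitive_one_level_one (Nat.coprime_one_right _) hpMr
      (Nat.Prime.not_dvd_one Fact.out) hp2 (by simpa using hBB)
  have he₁ : Valued.v (ι.symm (twoCharOneUnit ψ χ)) = 1 :=
    valuation_twoCharOneUnit_eq_one ψ χ ι hψprim hχ (Nat.Coprime.pow_left r hMN') hpMr hpN hp2
      (by simpa using hBA)
  have he : Valued.v (ι.symm (twoCharOneUnit ψ χ * twoCharTwoUnit ψ⁻¹ (1 : DirichletCharacter ℂ 1) *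
      ψ⁻¹ (N : ZMod (M ^ r)))) = 1 := by
    simp only [map_mul, he₂, he₁, valuation_inv_apply_level_eq_one ι hMN' ψ, one_mul]
  obtain ⟨H₀, h1, h2, h3⟩ := exists_integralForm_three χ ψ ι hr1 hMN' hψprim hχ hχodd hψ1
  obtain ⟨H, hH1, hH2, e, he', hH3⟩ := WashingtonLift.descend ι χ hMN' hMp ((3 : ℕ) : ℤ) r hr1
    H₀ h1 h2 ⟨_, he, h3⟩
  exact CuspFormLift.exists_cuspForm_nebentypus_congr_of_integralForm ι χ 3 hk M hM hMN hcusp H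
    hH1 hH2 e he' hH3

/-- **The cuspidal congruence `hC` for `k = 4` at every odd prime `p`** (the proof of
`cuspidalCongruence_four`, which uses `5 ≤ p` only through `p ≠ 2`).
[cite: BillereyMenares2016, §2, proof of Thm. 2.2 (p. 7)] [cite: Washington1978, Theorem]
[cite: Sinnott1987, §4.5] -/
theorem cuspidalCongruence_four_of_ne_two (ι : PadicAlgCl p ≃+* ℂ) {N : ℕ} [NeZero N]
    (χ : DirichletCharacter ℂ N) (hk : 3 ≤ 4) (M : ℕ) [NeZero M] (hp2 : p ≠ 2)
    (hχ : χ.IsPrimitive) (hpar : χ (-1) = (-1) ^ 4) (hpN : ¬ p ∣ N) (hM : M.Prime) (hMN : ¬ M ∣ N)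
    (hMp : M ≠ p)
    (hcusp : ∀ γ : SL(2, ℤ), ∃ c : ℂ,
      Tendsto ((⇑(eisensteinLevelRaised N 4 χ M hk) : ℍ → ℂ) ∣[((4 : ℕ) : ℤ)] γ) atImInfty (𝓝 c) ∧
        Valued.v (ι.symm c) < 1) :
    ∃ f₀ : CuspForm (Gamma1 (N * M)) (4 : ℕ),
      f₀ ∈ nebentypusSubspace (N * M) (4 : ℕ) (DirichletCharacter.changeLevel (dvd_mul_right N M) χ) ∧
      ∀ n, Valued.v (ι.symm (cuspCoeff f₀ n -
        (qExpansion 1 ⇑(eisensteinLevelRaised N 4 χ M hk)).coeff n)) < 1 := by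
  haveI hMf : Fact M.Prime := ⟨hM⟩
  have hMN' : M.Coprime N := (Nat.Prime.coprime_iff_not_dvd hM).2 hMN
  have hpM : ¬ p ∣ M := fun h ↦ hMp ((Nat.prime_dvd_prime_iff_eq Fact.out hM).mp h).symm
  have hχ1 : χ (-1) = 1 := by rw [hpar]; norm_num
  obtain ⟨r, hr1, ψ, hψprim, hψ1, hBA, hBB⟩ := exists_secondKind_two_units ι χ hMp hp2
    (n₁ := 2) (n₂ := 2) (by norm_num) (by norm_num) (by rw [hχ1]; norm_num) even_two
  have hpMr : ¬ p ∣ M ^ r := fun h ↦ hpM (Nat.Prime.dvd_of_dvd_pow Fact.out h)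
  have he₂ : Valued.v (ι.symm (twoCharTwoUnit ψ⁻¹ (1 : DirichletCharacter ℂ 1))) = 1 :=
    valuation_twoCharTwoUnit_eq_one ψ⁻¹ (1 : DirichletCharacter ℂ 1) ι
      (Literature.NumberTheory.LFunctions.isPrimitive_inv ψ hψprim)
      DirichletCharacter.isPrimitive_one_level_one (Nat.coprime_one_right _) hpMr
      (Nat.Prime.not_dvd_one Fact.out) hp2 (by simpa using hBB)
  have he₂' : Valued.v (ι.symm (twoCharTwoUnit ψ χ)) = 1 :=
    valuation_twoCharTwoUnit_eq_one ψ χ ι hψprim hχ (Nat.Coprime.pow_left r hMN') hpMr hpN hp2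
      (by simpa using hBA)
  have he : Valued.v (ι.symm (twoCharTwoUnit ψ χ * twoCharTwoUnit ψ⁻¹ (1 : DirichletCharacter ℂ 1) *
      ψ⁻¹ (N : ZMod (M ^ r)))) = 1 := by
    simp only [map_mul, he₂, he₂', valuation_inv_apply_level_eq_one ι hMN' ψ, one_mul]
  obtain ⟨H, hH1, hH2, e, he', hH3⟩ := WashingtonLift.descend ι χ hMN' hMp ((4 : ℕ) : ℤ) r hr1
    (prodFormB χ ψ)
    (fun γ hγ ↦ prodFormB_slash_of_mem_gamma0 χ ψ hγ)
    (valuation_qExpansion_coeff_prodFormB_le_one χ ψ ι hr1 hψprim hχ hχ1 hψ1)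
    ⟨_, he, tendsto_prodFormB_slash_atImInfty χ ψ hr1 hMN' hψprim hχ hχ1 hψ1⟩
  exact CuspFormLift.exists_cuspForm_nebentypus_congr_of_integralForm ι χ 4 hk M hM hMN hcusp H
    hH1 hH2 e he' hH3

/-- **The cuspidal congruence `hC` at every odd prime `p` and every Billerey–Menares weight**
(`k ∈ {p, p + 1} ∪ [3, p - 1]`): weight `3`, weight `4`, and `k ≥ 5` (which forces `p ≥ 5`).
[cite: BillereyMenares2016, §2, proof of Thm. 2.2 (p. 7)] -/
theorem cuspidalCongruence_odd (ι : PadicAlgCl p ≃+* ℂ) {N : ℕ} [NeZero N]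
    (χ : DirichletCharacter ℂ N) (k : ℕ) (hk : 3 ≤ k) (M : ℕ) [NeZero M] (hp2 : p ≠ 2)
    (hχ : χ.IsPrimitive) (hpar : χ (-1) = (-1) ^ k) (hpN : ¬ p ∣ N) (hM : M.Prime) (hMN : ¬ M ∣ N)
    (hMp : M ≠ p) (hkp : k = p ∨ k = p + 1 ∨ (3 ≤ k ∧ k + 1 ≤ p))
    (hcusp : ∀ γ : SL(2, ℤ), ∃ c : ℂ,
      Tendsto ((⇑(eisensteinLevelRaised N k χ M hk) : ℍ → ℂ) ∣[(k : ℤ)] γ) atImInfty (𝓝 c) ∧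
        Valued.v (ι.symm c) < 1) :
    ∃ f₀ : CuspForm (Gamma1 (N * M)) k,
      f₀ ∈ nebentypusSubspace (N * M) k (DirichletCharacter.changeLevel (dvd_mul_right N M) χ) ∧
      ∀ n, Valued.v (ι.symm (cuspCoeff f₀ n -
        (qExpansion 1 ⇑(eisensteinLevelRaised N k χ M hk)).coeff n)) < 1 := by
  have hp : p.Prime := Fact.out
  rcases Nat.lt_or_ge k 4 with h3 | h4
  · obtain rfl : k = 3 := by omega
    exact cuspidalCongruence_three_of_ne_two ι χ hk M hp2 hχ hpar hpN hM hMN hMp hcusp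
  rcases Nat.lt_or_ge k 5 with h4' | h5
  · obtain rfl : k = 4 := by omega
    exact cuspidalCongruence_four_of_ne_two ι χ hk M hp2 hχ hpar hpN hM hMN hMp hcusp
  · have hp4 : p ≠ 4 := by
      intro h; rw [h] at hp; norm_num at hp
    have hp5 : 5 ≤ p := by omega
    exact cuspidalCongruence_of_five_le ι χ k hk M hp5 hχ hpar hpN hM hMN hMp h5 hcusp

end Final

end WashingtonLift

end Literature.NumberTheory.EllipticCurves.ModularForms

namespace Literature.NumberTheory.EllipticCurves

open Literature.NumberTheory.EllipticCurves.ModularForms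

/-- **Billerey–Menares 2016, Thm. 2.2 for every odd prime `p` — the named fact
`BillereyMenares2016_thm22_exists_newform_odd` discharged.**  The printed proof (`E - E(M·)`,
constant terms at all cusps via Prop. 1.2, a `p`-integral lift with the exact nebentypus,
Deligne–Serre, newforms) is followed throughout; its one geometric input (Katz' lifting lemma /
Edixhoven's Lemma 1.9) is replaced by explicit Eisenstein products with unit constant terms
(Wiles 1980, §2) and Washington's theorem (1978; Sinnott 1987), so that `p = 3` and the primes
`p ∣ φ(NM)` are covered as well. [cite: BillereyMenares2016, §2, Thm. 2.2 and its proof (p. 7); Prop. 1.2]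
[cite: Washington1978, Theorem] [cite: Sinnott1987, §4.5] [cite: Wiles1980, §2]
[cite: DeligneSerreASENS1974, Lemme 6.11] -/
theorem BillereyMenares2016_thm22_exists_newform_odd_holds :
    BillereyMenares2016_thm22_exists_newform_odd :=
  BillereyMenares2016_thm22_exists_newform_odd_of_cuspidalCongruence
    fun _ _ ι _ _ χ k hk M _ hp2 hχ hpar hpN hM hMN hMp _ hkp _ hcusp ↦
      WashingtonLift.cuspidalCongruence_odd ι χ k hk M hp2 hχ hpar hpN hM hMN hMp hkp hcusp

end Literature.NumberTheory.EllipticCurves
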